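import Literature.LinearAlgebra.BaseChange.AutComplexFixedDescent
import Literature.RingTheory.Idempotents.CentralIdempotents
import HarnessLib

/-!
# `Aut(ℂ)` acts TRANSITIVELY on the complex blocks of a centrally primitive rational idempotent

Topic `RingTheory/Idempotents`; namespace `Literature.RingTheory.Idempotents`.  THEOREMS ONLY (★ `AutComplexFixedDescent` (G3) + ★
`CentralIdempotents`; no definition, no named fact, no instance, no `sorry`).  Cell hodgecm-mathlib, d6 line, next-run DH2c (A-p09 (g13)
census `CENSUS-DH1-DH2.A-p09g13.md`; hand-over 2026-08-29T21:43:26Z (ii) «(G4)»): for the semisimple ℚ-algebra `heckeImage` and a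
simple factor with central idempotent `ε_j`, the complex blocks `e_π` of `ℂ ⊗ heckeImage` below `1 ⊗ ε_j` form ONE `Aut(ℂ/ℚ)`-orbit —
print [Liu2021] App. D p. 133 «through the coefficients» (the Galois-conjugates `π^σ` of an automorphic representation index the block).

MATHEMATICS ([Lam2001FirstCourse] §22, (22.1): central idempotents below a centrally primitive one; [Milne2017] Cor. 4.34 / Galois
descent for the rationality step).  Let `A` be a ℚ-algebra, `e ∈ A` CENTRALLY PRIMITIVE (★ `IsCentrallyPrimitive`: a non-zero central
idempotent with no central idempotent strictly between `0` and `e`), and `(c_i)_{i ∈ I}` a finite family of pairwise orthogonal, non-zero,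
central idempotents of `B = ℂ ⊗_ℚ A` with `Σ_i c_i = 1 ⊗ e`, STABLE under the automorphisms `θ_τ = τ ⊗ id` (`τ ∈ Aut(ℂ)`).  Then for all
`i, j` some `θ_τ` carries `c_i` to `c_j`.  Proof: the orbit sum `ε_O = Σ_{k ∈ O(i)} c_k` is fixed by every `θ_τ` (which permutes the
finite set `{c_k : k ∈ O(i)}`), hence `ε_O = 1 ⊗ ε` with `ε ∈ A` (★ (G3) `exists_one_tmul_eq_of_forall_map_aut_eq`); reading through the
injection `a ↦ 1 ⊗ a`, `ε` is a non-zero central idempotent of `A` with `ε e = ε`, so `ε = e` by central primitivity, `ε_O = Σ_i c_i`, and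
orthogonality forces `O(i) = I`.

CONTENT: §1 the automorphisms `θ_τ` (`map_aut_one_apply`, `map_aut_mul_apply`, `map_aut_injective`, `map_aut_one_tmul`); §2 orthogonal
families (`sum_mul_apply_eq_ite`); §3 **`forall_exists_map_aut_apply_eq_of_isCentrallyPrimitive`** (transitivity) and the rationality
by-product `exists_one_tmul_eq_sum_of_forall_map_aut_stable` (a `θ`-stable subfamily sums to `1 ⊗ ε`, `ε` a central idempotent `≤ e`).
HC_CM is proved only modulo the 7 printed citations until rung 0 closes; nothing here moves a book.

## References
* [Lam2001FirstCourse] T. Y. Lam, *A First Course in Noncommutative Rings*, 2nd ed., GTM 131 (2001), §22, Prop. (22.1) (p. 326).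
* [Milne2017] J. S. Milne, *Algebraic Groups*, CUP (2017), Ch. 4 §i, Prop. 4.31 and Cor. 4.34 (Galois descent of fixed vectors).
* [Liu2021] Y. Liu, Camb. J. Math. **9** (2021), App. D (D.3) p. 133 (the consumer).
-/

set_option autoImplicit false

noncomputable section

open scoped TensorProduct

namespace Literature.RingTheory.Idempotents

variable {A : Type*} [Ring A] [Algebra ℚ A]

/-! ## §1 The automorphisms `θ_τ = τ ⊗ id` of `ℂ ⊗_ℚ A` -/

/-- `θ_τ (z ⊗ a) = τ z ⊗ a`. [cite: Milne2017, Prop. 4.31 and Cor. 4.34] -/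
theorem map_aut_tmul (τ : ℂ ≃+* ℂ) (z : ℂ) (a : A) :
    Algebra.TensorProduct.map τ.toRingHom.toRatAlgHom (AlgHom.id ℚ A) (z ⊗ₜ[ℚ] a) = τ z ⊗ₜ[ℚ] a :=
  Algebra.TensorProduct.map_tmul _ _ _ _

/-- `θ_1 = id`. [cite: Milne2017, Prop. 4.31 and Cor. 4.34] -/
theorem map_aut_one_apply (x : ℂ ⊗[ℚ] A) :
    Algebra.TensorProduct.map (1 : ℂ ≃+* ℂ).toRingHom.toRatAlgHom (AlgHom.id ℚ A) x = x := by
  induction x using TensorProduct.induction_on with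
  | zero => rw [map_zero]
  | tmul z a => rw [map_aut_tmul]; rfl
  | add x y hx hy => rw [map_add, hx, hy]

/-- `θ_{τσ} = θ_τ ∘ θ_σ`. [cite: Milne2017, Prop. 4.31 and Cor. 4.34] -/
theorem map_aut_mul_apply (τ σ : ℂ ≃+* ℂ) (x : ℂ ⊗[ℚ] A) :
    Algebra.TensorProduct.map (τ * σ).toRingHom.toRatAlgHom (AlgHom.id ℚ A) x =
      Algebra.TensorProduct.map τ.toRingHom.toRatAlgHom (AlgHom.id ℚ A)
        (Algebra.TensorProduct.map σ.toRingHom.toRatAlgHom (AlgHom.id ℚ A) x) := by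
  induction x using TensorProduct.induction_on with
  | zero => rw [map_zero, map_zero, map_zero]
  | tmul z a => rw [map_aut_tmul, map_aut_tmul, map_aut_tmul]; rfl
  | add x y hx hy => rw [map_add, map_add, map_add, hx, hy]

/-- `θ_τ` is injective (its inverse is `θ_{τ⁻¹}`). [cite: Milne2017, Prop. 4.31 and Cor. 4.34] -/
theorem map_aut_injective (τ : ℂ ≃+* ℂ) :
    Function.Injective (Algebra.TensorProduct.map τ.toRingHom.toRatAlgHom (AlgHom.id ℚ A)) := by
  intro x y h
  have h' := congrArg (Algebra.TensorProduct.map τ⁻¹.toRingHom.toRatAlgHom (AlgHom.id ℚ A)) h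
  rwa [← map_aut_mul_apply, ← map_aut_mul_apply, inv_mul_cancel, map_aut_one_apply, map_aut_one_apply] at h'

/-- `θ_τ (1 ⊗ a) = 1 ⊗ a`. [cite: Milne2017, Prop. 4.31 and Cor. 4.34] -/
theorem map_aut_one_tmul (τ : ℂ ≃+* ℂ) (a : A) :
    Algebra.TensorProduct.map τ.toRingHom.toRatAlgHom (AlgHom.id ℚ A) ((1 : ℂ) ⊗ₜ[ℚ] a) = (1 : ℂ) ⊗ₜ[ℚ] a := by
  rw [map_aut_tmul, map_one]

/-! ## §2 Finite orthogonal families of idempotents -/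

/-- `(Σ_{l ∈ S} c_l) c_k = c_k` if `k ∈ S`, else `0`, for pairwise orthogonal idempotents. [cite: Lam2001FirstCourse, §22 Prop. (22.1) (proof), p. 326] -/
theorem sum_mul_apply_eq_ite {R : Type*} [Ring R] {I : Type*} [DecidableEq I] {c : I → R} (hc : OrthogonalIdempotents c)
    (S : Finset I) (k : I) : (∑ l ∈ S, c l) * c k = if k ∈ S then c k else 0 := by
  rw [Finset.sum_mul]
  split_ifs with h
  · rw [Finset.sum_eq_single_of_mem k h fun l _ hlk => hc.ortho hlk]
    exact (hc.idem k).eq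
  · exact Finset.sum_eq_zero fun l hl => hc.ortho fun h' : l = k => h (h' ▸ hl)

/-- Pairwise orthogonal NON-ZERO idempotents are pairwise distinct. [cite: Lam2001FirstCourse, §22 Prop. (22.1) (proof), p. 326] -/
theorem injective_of_orthogonalIdempotents_of_ne_zero {R : Type*} [Ring R] {I : Type*} {c : I → R}
    (hc : OrthogonalIdempotents c) (hne : ∀ i, c i ≠ 0) : Function.Injective c := by
  intro k l h
  by_contra hkl
  apply hne k
  have h0 : c k * c l = 0 := hc.ortho hkl
  rwa [← h, (hc.idem k).eq] at h0

/-! ## §3 Transitivity of `Aut(ℂ)` on the complex blocks below a centrally primitive rational idempotent -/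

section Orbit

variable {I : Type*} [Fintype I] [DecidableEq I] {c : I → ℂ ⊗[ℚ] A}

/-- **A `θ`-stable subfamily sums to a RATIONAL central idempotent below `e`.**  If `(c_i)` are pairwise orthogonal central idempotents
of `ℂ ⊗_ℚ A` summing to `1 ⊗ e` and `S ⊆ I` indexes a subfamily whose set `{c_k : k ∈ S}` is mapped into itself by every `θ_τ`, then
`Σ_{k ∈ S} c_k = 1 ⊗ ε` for a central idempotent `ε` of `A` with `ε e = ε` (Galois descent ★ (G3) + reading through `a ↦ 1 ⊗ a`).
[cite: Milne2017, Prop. 4.31 and Cor. 4.34] [cite: Lam2001FirstCourse, §22 Prop. (22.1) (1), p. 326] -/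
theorem exists_one_tmul_eq_sum_of_forall_map_aut_stable (hc : OrthogonalIdempotents c) (hcz : ∀ i (x : ℂ ⊗[ℚ] A), c i * x = x * c i)
    (hne : ∀ i, c i ≠ 0) {e : A} (hsum : ∑ i, c i = (1 : ℂ) ⊗ₜ[ℚ] e) (S : Finset I)
    (hS : ∀ (τ : ℂ ≃+* ℂ), ∀ k ∈ S, ∃ k' ∈ S, Algebra.TensorProduct.map τ.toRingHom.toRatAlgHom (AlgHom.id ℚ A) (c k) = c k') :
    ∃ ε : A, (1 : ℂ) ⊗ₜ[ℚ] ε = ∑ k ∈ S, c k ∧ IsIdempotentElem ε ∧ (∀ a : A, ε * a = a * ε) ∧ ε * e = ε := by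
  classical
  have hcinj := injective_of_orthogonalIdempotents_of_ne_zero hc hne
  -- the orbit sum is `θ`-fixed: `θ_τ` permutes the finite set `{c_k : k ∈ S}`
  have hfix : ∀ τ : ℂ ≃+* ℂ, Algebra.TensorProduct.map τ.toRingHom.toRatAlgHom (AlgHom.id ℚ A) (∑ k ∈ S, c k) = ∑ k ∈ S, c k := by
    intro τ
    have hθinj := map_aut_injective (A := A) τ
    have hsumT : ∑ k ∈ S, c k = ∑ x ∈ S.image c, x :=
      (Finset.sum_image (f := fun x : ℂ ⊗[ℚ] A => x) fun k _ l _ h => hcinj h).symm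
    have hsub : (S.image c).image (Algebra.TensorProduct.map τ.toRingHom.toRatAlgHom (AlgHom.id ℚ A)) ⊆ S.image c := by
      intro y hy
      obtain ⟨x, hx, rfl⟩ := Finset.mem_image.1 hy
      obtain ⟨k, hk, rfl⟩ := Finset.mem_image.1 hx
      obtain ⟨k', hk', hkk'⟩ := hS τ k hk
      exact Finset.mem_image.2 ⟨k', hk', hkk'.symm⟩
    have heq : (S.image c).image (Algebra.TensorProduct.map τ.toRingHom.toRatAlgHom (AlgHom.id ℚ A)) = S.image c :=
      Finset.eq_of_subset_of_card_le hsub (by rw [Finset.card_image_of_injective _ hθinj])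
    calc Algebra.TensorProduct.map τ.toRingHom.toRatAlgHom (AlgHom.id ℚ A) (∑ k ∈ S, c k)
        = ∑ x ∈ S.image c, Algebra.TensorProduct.map τ.toRingHom.toRatAlgHom (AlgHom.id ℚ A) x := by rw [hsumT, map_sum]
      _ = ∑ y ∈ (S.image c).image (Algebra.TensorProduct.map τ.toRingHom.toRatAlgHom (AlgHom.id ℚ A)), y :=
          (Finset.sum_image (f := fun y : ℂ ⊗[ℚ] A => y) fun x _ y _ h => hθinj h).symm
      _ = ∑ x ∈ S.image c, x := by rw [heq]
      _ = ∑ k ∈ S, c k := hsumT.symm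
  obtain ⟨ε, hε⟩ := Literature.LinearAlgebra.BaseChange.exists_one_tmul_eq_of_forall_map_aut_eq hfix
  have hinj := (Literature.LinearAlgebra.BaseChange.one_tmul_injective (U := A))
  -- the orbit sum is an idempotent, central, below `1 ⊗ e`
  have hOO : (∑ k ∈ S, c k) * (∑ k ∈ S, c k) = ∑ k ∈ S, c k := by
    rw [Finset.mul_sum]
    exact Finset.sum_congr rfl fun k hk => by rw [sum_mul_apply_eq_ite hc, if_pos hk]
  have hOe : (∑ k ∈ S, c k) * ((1 : ℂ) ⊗ₜ[ℚ] e) = ∑ k ∈ S, c k := by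
    rw [← hsum, Finset.mul_sum, ← Finset.sum_filter_of_ne (s := Finset.univ) (p := fun k => k ∈ S)
      (fun k _ hk => by by_contra h; exact hk (by rw [sum_mul_apply_eq_ite hc, if_neg h]))]
    rw [Finset.filter_mem_eq_inter, Finset.univ_inter]
    exact Finset.sum_congr rfl fun k hk => by rw [sum_mul_apply_eq_ite hc, if_pos hk]
  refine ⟨ε, hε, ?_, fun a => ?_, ?_⟩
  · apply hinj
    show (1 : ℂ) ⊗ₜ[ℚ] (ε * ε) = (1 : ℂ) ⊗ₜ[ℚ] ε
    rw [← one_mul (1 : ℂ), ← Algebra.TensorProduct.tmul_mul_tmul, one_mul, hε, hOO]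
  · apply hinj
    show (1 : ℂ) ⊗ₜ[ℚ] (ε * a) = (1 : ℂ) ⊗ₜ[ℚ] (a * ε)
    have h1 : (1 : ℂ) ⊗ₜ[ℚ] (ε * a) = ((1 : ℂ) ⊗ₜ[ℚ] ε) * ((1 : ℂ) ⊗ₜ[ℚ] a) := by
      rw [Algebra.TensorProduct.tmul_mul_tmul, one_mul]
    have h2 : (1 : ℂ) ⊗ₜ[ℚ] (a * ε) = ((1 : ℂ) ⊗ₜ[ℚ] a) * ((1 : ℂ) ⊗ₜ[ℚ] ε) := by
      rw [Algebra.TensorProduct.tmul_mul_tmul, one_mul]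
    rw [h1, h2, hε, Finset.sum_mul, Finset.mul_sum]
    exact Finset.sum_congr rfl fun k _ => hcz k _
  · apply hinj
    show (1 : ℂ) ⊗ₜ[ℚ] (ε * e) = (1 : ℂ) ⊗ₜ[ℚ] ε
    rw [← one_mul (1 : ℂ), ← Algebra.TensorProduct.tmul_mul_tmul, one_mul, hε, hOe]

/-- **`Aut(ℂ)` IS TRANSITIVE ON THE COMPLEX BLOCKS BELOW A CENTRALLY PRIMITIVE RATIONAL IDEMPOTENT.**  Let `e ∈ A` be centrally primitive and
`(c_i)_{i ∈ I}` pairwise orthogonal, non-zero, central idempotents of `ℂ ⊗_ℚ A` with `Σ_i c_i = 1 ⊗ e`, stable under every `θ_τ = τ ⊗ id`.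
Then for all `i, j` there is `τ ∈ Aut(ℂ)` with `θ_τ (c_i) = c_j`: the orbit sum through `i` is `1 ⊗ ε` with `ε` a non-zero central
idempotent below `e` (previous theorem), so `ε = e` by central primitivity (★ `isCentrallyPrimitive_iff`), the orbit sum is `Σ_i c_i`, and an
index outside the orbit would carry `c_j = c_j (Σ_i c_i) = 0`. [cite: Lam2001FirstCourse, §22 Prop. (22.1) (1)–(2), p. 326]
[cite: Milne2017, Prop. 4.31 and Cor. 4.34] -/
theorem forall_exists_map_aut_apply_eq_of_isCentrallyPrimitive (hc : OrthogonalIdempotents c)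
    (hcz : ∀ i (x : ℂ ⊗[ℚ] A), c i * x = x * c i) (hne : ∀ i, c i ≠ 0) {e : A} (he : IsCentrallyPrimitive e)
    (hsum : ∑ i, c i = (1 : ℂ) ⊗ₜ[ℚ] e)
    (hstab : ∀ (τ : ℂ ≃+* ℂ) (i : I), ∃ j, Algebra.TensorProduct.map τ.toRingHom.toRatAlgHom (AlgHom.id ℚ A) (c i) = c j)
    (i j : I) : ∃ τ : ℂ ≃+* ℂ, Algebra.TensorProduct.map τ.toRingHom.toRatAlgHom (AlgHom.id ℚ A) (c i) = c j := by
  classical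
  -- the orbit of `i`
  let O : Finset I := Finset.univ.filter fun k => ∃ τ : ℂ ≃+* ℂ,
    Algebra.TensorProduct.map τ.toRingHom.toRatAlgHom (AlgHom.id ℚ A) (c i) = c k
  have hmemO : ∀ k, k ∈ O ↔ ∃ τ : ℂ ≃+* ℂ, Algebra.TensorProduct.map τ.toRingHom.toRatAlgHom (AlgHom.id ℚ A) (c i) = c k :=
    fun k => by simp [O]
  have hiO : i ∈ O := (hmemO i).2 ⟨1, map_aut_one_apply _⟩
  have hstabO : ∀ (τ : ℂ ≃+* ℂ), ∀ k ∈ O, ∃ k' ∈ O,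
      Algebra.TensorProduct.map τ.toRingHom.toRatAlgHom (AlgHom.id ℚ A) (c k) = c k' := by
    intro τ k hk
    obtain ⟨σ, hσ⟩ := (hmemO k).1 hk
    obtain ⟨k', hk'⟩ := hstab τ k
    refine ⟨k', (hmemO k').2 ⟨τ * σ, ?_⟩, hk'⟩
    rw [map_aut_mul_apply, hσ, hk']
  obtain ⟨ε, hε, hεi, hεz, hεe⟩ := exists_one_tmul_eq_sum_of_forall_map_aut_stable hc hcz hne hsum O hstabO
  -- `ε ≠ 0`: the orbit sum absorbs `c_i ≠ 0`
  have hε0 : ε ≠ 0 := by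
    intro h0
    apply hne i
    have h1 : (∑ k ∈ O, c k) * c i = c i := by rw [sum_mul_apply_eq_ite hc, if_pos hiO]
    rw [← h1, ← hε, h0, TensorProduct.tmul_zero, zero_mul]
  -- central primitivity: `ε = e`, so the orbit sum is everything
  have hεe' : ε = e := ((isCentrallyPrimitive_iff.1 he).2.2.2 ε hεi hεz hεe).resolve_left hε0
  have hall : ∑ k ∈ O, c k = ∑ k, c k := by rw [← hε, hεe', hsum]
  -- hence `j ∈ O`
  by_contra hj
  have hjO : j ∉ O := fun h => hj ((hmemO j).1 h)
  apply hne j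
  have h1 : (∑ k, c k) * c j = c j := by rw [sum_mul_apply_eq_ite hc, if_pos (Finset.mem_univ j)]
  rw [← h1, ← hall, sum_mul_apply_eq_ite hc, if_neg hjO]

end Orbit

end Literature.RingTheory.Idempotents
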